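import Summits.NavierStokesRegularity.NavierStokesRegularity.Theorems.ExtremiserTransienceBangBangCoreDefs
import Summits.NavierStokesRegularity.NavierStokesRegularity.Theorems.ExtremiserTransienceZoneTransversalityDefs
import Summits.NavierStokesRegularity.NavierStokesRegularity.Theorems.ExtremiserTransienceLocalMaximiserDefs
import Summits.NavierStokesRegularity.NavierStokesRegularity.Theorems.ExtremiserTransienceLocalMaximiserLimitDefs
import HarnessLib

/-!
# Route `ExtremiserTransience`, crux `NearExtremalTransiencePerFlow` (stmt-NavierStokesRegularity-26567),
# LINE g10-1 `two_thirds` (ns-idea-10 g10): THE VOCABULARY AND THE THREE STATEMENTS OF THE LINE (texts of record)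

Texts of record, VERBATIM §1 (ball functionals and good balls) and §2 (the three stub statements, without the `Sig.` prefix —
same convention as `…LocalMaximiserLimitDefs`) of the registered skeleton
`Summits/NavierStokesRegularity/NavierStokesRegularity/Cruxes/NearExtremalTransience/Lines/two_thirds.lean` (planner ns-idea-10 g10,
REV 1.2, commit 9b1e29b3e15f; verdict PASS V124/V124a/N133), over the SAME Theorems-side vocabulary the skeleton imports
(`…BangBangCoreDefs`: `IsAdm IsReg lam Zen Wpa Jst`; `…LocalMaximiserDefs`: `sd zd wd locGain IsTestAt`; `…LocalMaximiserLimitDefs`: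
`InLimitClass`; `…ZoneTransversalityDefs`: `IsViolator`; `KStar.HalfSpace`: `E3 kStar`), so that the by-text stubs
S1a `stub_typicalSelection : Sig.TypicalSelection`, S1b `stub_extremalExtraction : Sig.ExtremalExtraction` and
S2 `stub_firstOrderIdentity : Sig.FirstOrderIdentity` can be landed as Theorems files concluding these statements BY NAME
(a Theorems file may not import a `Cruxes/` skeleton; the bodies are identical, so the skeleton closes its `sorry`s by `exact`):

* `Jb Zb Wb` (+ `Zb_nonneg Wb_nonneg`), `IsGoodBall`, `IsDoubling`, `IsGoodBallAt` — §1 verbatim;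
* `TypicalSelection` (S1a, L), `ExtremalExtraction` (S1b, M), `FirstOrderIdentity` (S2, M/L) — §2 verbatim.

HONEST FRAMING: definitions (and two one-line nonnegativity lemmas) only; S1a/S1b/S2, the crux ⟨26567⟩ and NS regularity are OPEN;
nothing about Navier–Stokes regularity or blow-up is proved; no summit is proved by a line.
-/

noncomputable section

open scoped Topology InnerProductSpace RealInnerProductSpace ENNReal ContDiff
open MeasureTheory Filter Set
open Literature.Analysis.FluidPDE
open Summit.NavierStokesRegularity.NavierStokesRegularity.Theorems.DepletionLadder.KStar.HalfSpace
open Summit.NavierStokesRegularity.NavierStokesRegularity.Theorems.DepletionLadder.KStar.BangBang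
open Summit.NavierStokesRegularity.NavierStokesRegularity.Theorems.NearExtremalTransiencePerFlow.ZoneTransversality
open Summit.NavierStokesRegularity.NavierStokesRegularity.Theorems.NearExtremalTransiencePerFlow.LocalMaximiser

namespace Summit.NavierStokesRegularity.NavierStokesRegularity.Theorems.NearExtremalTransiencePerFlow.TwoThirds

-- the problem directory repeats the summit name (`NavierStokesRegularity/NavierStokesRegularity`)
set_option linter.dupNamespace false

/-! ## §1 Ball functionals and good balls -/

/-- Local stretching content `J_B = ∫_{B(c,R)} ⟪ω, DV ω⟫`. -/
def Jb (V : E3 → E3) (c : E3) (R : ℝ) : ℝ := ∫ x in Metric.ball c R, sd V x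

/-- Local enstrophy `Z_B = ∫_{B(c,R)} |ω|²`. -/
def Zb (V : E3 → E3) (c : E3) (R : ℝ) : ℝ := ∫ x in Metric.ball c R, zd V x

/-- Local palinstrophy `W_B = ∫_{B(c,R)} |∇ω|²`. -/
def Wb (V : E3 → E3) (c : E3) (R : ℝ) : ℝ := ∫ x in Metric.ball c R, wd V x

/-- `0 ≤ Z_B`. -/
theorem Zb_nonneg (V : E3 → E3) (c : E3) (R : ℝ) : 0 ≤ Zb V c R :=
  setIntegral_nonneg measurableSet_ball fun _ _ => sq_nonneg _

/-- `0 ≤ W_B`. -/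
theorem Wb_nonneg (V : E3 → E3) (c : E3) (R : ℝ) : 0 ≤ Wb V c R :=
  setIntegral_nonneg measurableSet_ball fun _ _ => frobeniusNormSq_nonneg _

/-- GOOD BALL of the limit (cell units: height `1`, Taylor length `1`) with tolerance `δ`:
(i) LOCALLY EXTREMAL `κ⋆·√(Z_B W_B)·(1 − δ) ≤ J_B`; (ii) UNIT TAYLOR RATIO `|W_B − Z_B| ≤ δ·Z_B`;
(iii) LIGHT LAYER: the shell of width `R^{7/8}` outside `B(c,R)` carries at most `δ·bulk(R)`.  All three are CLOSED
conditions in `V` (stable under `C²_loc` limits at fixed `c, R`) and all three are TYPICAL (Chebyshev) consequences of global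
near-extremality — unlike doubling, which is kept apart (`IsDoubling`). -/
def IsGoodBall (V : E3 → E3) (c : E3) (R δ : ℝ) : Prop :=
  kStar * Real.sqrt (Zb V c R * Wb V c R) * (1 - δ) ≤ Jb V c R ∧
  |Wb V c R - Zb V c R| ≤ δ * Zb V c R ∧
  (Zb V c (R + R ^ (7 / 8 : ℝ)) + Wb V c (R + R ^ (7 / 8 : ℝ))) - (Zb V c R + Wb V c R) ≤ δ * (Zb V c R + Wb V c R)

/-- DOUBLING at `(c, R)` with constant `D`: `bulk(B(c,4R)) ≤ D · bulk(B(c,R))`.  NOT inheritable at every scale (hierarchical crowds); in the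
limit class it holds at infinitely many scales around a point of non-zero curl for any `D > 4⁹` by polynomial growth of the bulk and `Z ≥ b₀`
(the counting behind g9's PROVED `exists_scaleRegular`); S2 is uniform over `D`. -/
def IsDoubling (V : E3 → E3) (c : E3) (R D : ℝ) : Prop :=
  Zb V c (4 * R) + Wb V c (4 * R) ≤ D * (Zb V c R + Wb V c R)

/-- GOOD BALL of a SLICE `v` of height `M` and Taylor length `λ` around `x`, radius `r` in Taylor units (so `B(x, rλ)`),
tolerance `δ`: the same three clauses in cell units (bulk `Z_B + λ²W_B`; the extremality clause is the restriction of the global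
sharp inequality `J ≤ κ⋆ M √Z √W`, which carries no `λ`). -/
def IsGoodBallAt (v : E3 → E3) (M lam' : ℝ) (x : E3) (r δ : ℝ) : Prop :=
  kStar * M * Real.sqrt (Zb v x (r * lam') * Wb v x (r * lam')) * (1 - δ) ≤ Jb v x (r * lam') ∧
  |lam' ^ 2 * Wb v x (r * lam') - Zb v x (r * lam')| ≤ δ * Zb v x (r * lam') ∧
  (Zb v x ((r + r ^ (7 / 8 : ℝ)) * lam') + lam' ^ 2 * Wb v x ((r + r ^ (7 / 8 : ℝ)) * lam')) -
      (Zb v x (r * lam') + lam' ^ 2 * Wb v x (r * lam')) ≤ δ * (Zb v x (r * lam') + lam' ^ 2 * Wb v x (r * lam'))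

/-! ## §2 The three stub statements (skeleton `namespace Sig`, here without the prefix) -/

/-- S1a · TYPICAL SELECTION (L; the new lever, slice level).  In the `A`-regular admissible class with LINEAR ENERGY GROWTH in
cell units (`∫_{B(y, rλ)} |v|² ≤ A_E M² λ³ r`, Seregin's scaled energy of Type-I flows) there are `θ₀, K > 0` such that for
every radius `R`, gain tolerance `η` and number of scales `m` some `ε₀ > 0` works: a `(κ⋆ − ε)`-extremal slice with `ε ≤ ε₀`
has a centre `x₀` which is (a) THICK `‖curl v x₀‖ ≥ θ₀ M/λ`, (b) GOOD in g9's sense (every admissible local test inside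
`B(x₀, Rλ)` gains `≤ η M³`; this is the landed `Selection`), and (c) ENSTROPHY-TYPICAL AT EVERY SCALE `4^i`, `i < m`: a good
ball `IsGoodBallAt v M λ c r (K/(i+1))` of radius `r ∈ [4^i, 2·4^i]` (Taylor units) with centre NEAR `x₀` (`dist c x₀ ≤ rλ/2`,
REV 1.1 — what typicality gives).  Route: for each translate `τ` of the packing `{B(z+τ, rλ) : z ∈ 4rλ·ℤ³}` plus its
complement, the cut-off fields `φ_B = curl(χ_B ψ)` (thin layers `ℓ = r^{7/8}λ`) are admissible, `J = Σ_B J(φ_B) + J(φ_rest) + E`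
with `|E| ≲ (layer bulk + gauge junk)`, and the three DEFECTS — sharp inequality per piece `κ⋆M_B√(Z(φ_B)W(φ_B)) − J(φ_B) ≥ 0`,
height `M − M_B ≥ 0`, AM–GM `½(√Z − λ√W)² ≥ 0` per piece — sum to `≤ (ε + o_r(1))·M√Z√W`; entirely THIN pieces
(`|ω| < θ₀M/λ`) are inefficient (g9's thin-vorticity bound) and thick pieces have `Z_B ≥ c(A,θ₀)M²λ` by `A`-regularity, so their
number is `≤ Z/(cM²λ)` and the junk sum is `o_r(1)·M√Z√W` by Cauchy–Schwarz WITHOUT any diluteness case; Chebyshev in the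
`Z_B`-weight, then AVERAGING OVER `τ` and a Vitali covering turn «weight-most pieces of each packing are good» into «for
enstrophy-most points `y`, some centre within `rλ/2` of `y` carries a good ball» at each scale; union bound over `i < m`
(`ε₀` is chosen after `m`, `K`), intersected with the enstrophy-large set of thick good centres of g9's selection.  Why it
might fail: the zeroth-order cut-off junk `∫_{layer}|v|²ℓ^{-2}` is paid by LINEAR GROWTH only (`≤ A_E M²λ³ r²/ℓ³`-type per
thick piece), and g9's `Selection` must be re-run to give an enstrophy-LARGE set of admissible centres rather than one —
both elementary but unwritten (L for length, not for risk). -/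
def TypicalSelection : Prop :=
  ∀ A : ℕ → ℝ, (∀ j, 1 ≤ A j) → ∀ A_E : ℝ, 0 < A_E → ∃ θ₀ K : ℝ, 0 < θ₀ ∧ 0 < K ∧
    ∀ (R η : ℝ) (m : ℕ), 0 < R → 0 < η → ∃ ε₀ : ℝ, 0 < ε₀ ∧
    ∀ (v : E3 → E3) (M B ε : ℝ), IsAdm v M B → IsReg A v M → 0 < Zen v → 0 < Wpa v → 0 ≤ ε → ε ≤ ε₀ →
      (kStar - ε) * M * Real.sqrt (Zen v) * Real.sqrt (Wpa v) ≤ Jst v →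
      (∀ (y : E3) (r : ℝ), 0 < r → ∫ x in Metric.ball y (r * lam v), ‖v x‖ ^ 2 ≤ A_E * M ^ 2 * lam v ^ 3 * r) →
      ∃ x₀ : E3, θ₀ * M * (lam v)⁻¹ ≤ ‖curl v x₀‖ ∧
        (∀ φ : E3 → E3, IsTestAt v M φ → tsupport φ ⊆ Metric.ball x₀ (R * lam v) →
          locGain (kStar * M) (lam v) v φ ≤ η * M ^ 3) ∧
        ∀ i : ℕ, i < m → ∃ (c : E3) (r : ℝ), dist c x₀ ≤ r * lam v / 2 ∧ (4 : ℝ) ^ i ≤ r ∧ r ≤ 2 * (4 : ℝ) ^ i ∧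
          IsGoodBallAt v M (lam v) c r (K / (i + 1))

/-- S1b · EXTREMAL EXTRACTION (M).  Given the typical selection S1a, every violator flow (`IsViolator`) yields a field of the
limit class `InLimitClass A A_E` (analytic, divergence free, height `≤ 1`, derivative budget `A`, linear growth `A_E`, robust
local maximiser of `F̃` — exactly g9's L3 output, landed as `extraction_holds` at a thick good centre) which is moreover
ASYMPTOTICALLY EXTREMAL AROUND THE ORIGIN AT INFINITELY MANY DOUBLING SCALES (REV 1.1): for every `i₀` some `i ≥ i₀`, a
centre `c` and a radius `r ∈ [4^i, 2·4^i]` with `Z_{B(c,r)} ≥ b₀ > 0`, doubling `bulk(B(c,4r)) ≤ D·bulk(B(c,r))` and a good ball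
`IsGoodBall V c r (K/(i+1))`.  Route: the landed zoom (`…LocalMaximiserZoom/GainLimit/Slices/Extraction`, `extraction_holds`)
run at the S1a centre with `m = m(k) → ∞`; centres `c_i^{(k)}` (`|c| ≤ r/2` in cell units) and radii converge along a diagonal
subsequence; the three clauses of `IsGoodBallAt` are closed under the `C²_loc` convergence of the normalised slices (`M_k = 1`,
`λ_k = 1`) and continuity of `(c,r) ↦ ∫_{B(c,r)}` — so the limit has a good ball near `0` at EVERY scale; `b₀ ≤ Z_{B(0,1/2)} ≤
Z_{B(c,r)}` from thickness `‖curl V 0‖ ≥ θ₀` and the derivative budget; DOUBLING at infinitely many of these scales with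
`D = 4^{10}·…` from `b₀ ≤ bulk(B(0,ρ)) ≤ C(A)ρ³` by counting 4-adic steps (`bulk(B(c,4r)) ≤ bulk(B(0,4^{i+2}))`,
`bulk(B(c,r)) ≥ bulk(B(0,4^{i-1}))`; g9's `exists_step_ratio_le`).  Why it might fail: only book-keeping beyond the landed
extraction (the same good times — near-efficient AND upper-locked — serve; the slice-level linear-growth constant must be the
one the landed extraction already carries into `HasLinearGrowth`). -/
def ExtremalExtraction : Prop :=
  TypicalSelection →
  ∀ (C ν T : ℝ) (u : ℝ → E3 → E3) (p : ℝ → E3 → ℝ), IsViolator C ν T u p →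
    ∃ (A : ℕ → ℝ) (A_E : ℝ) (V : E3 → E3) (K b₀ D : ℝ), (∀ j, 1 ≤ A j) ∧ 0 < A_E ∧ InLimitClass A A_E V ∧
      0 < K ∧ 0 < b₀ ∧ 0 < D ∧
      ∀ i₀ : ℕ, ∃ (i : ℕ) (c : E3) (r : ℝ), i₀ ≤ i ∧ (4 : ℝ) ^ i ≤ r ∧ r ≤ 2 * (4 : ℝ) ^ i ∧ b₀ ≤ Zb V c r ∧
        IsDoubling V c r D ∧ IsGoodBall V c r (K / (i + 1))

/-- S2 · FIRST-ORDER IDENTITY AT INFINITY (M).  For `V` in the limit class, every doubling constant `D > 0` and every `ε > 0`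
there are a layer tolerance `η > 0` and a threshold `R₁` such that on every ball `B(c,R)`, `R ≥ R₁`, which is `D`-doubling
(`bulk(4R) ≤ D·bulk(R)`) and has an `η`-light layer of width `R^{7/8}`,
    `|3·J_B(V) − κ⋆·(Z_B(V) + W_B(V))| ≤ ε·(1 + Z_B(V) + W_B(V))`.
Route: the contact set `{‖V‖ = 1}` has empty interior (g9's `noPlateau_of_linearGrowth`, PROVED: analyticity + linear growth);
hence the Euler–Lagrange identity `a₁(curl η) = 0` for every smooth compactly supported potential `η` (g9's
`eulerLagrange_holds`, PROVED — two-sided tests in the open dense slack set, continuity of the density `KStar.exists_density`);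
take `η = χψ` with `χ = 1` on `B(c,R)`, `χ = 0` off `B(c, R + R^{7/8})`, `|∇ʲχ| ≲ R^{-7j/8}`, and `ψ` the vector potential of `V`
on `B(c,4R)` in the linear-growth gauge (`|ψ| ≤ C√A_E·log R` by dyadic Cauchy–Schwarz); g9's `a1_layer` (PROVED) turns
`a₁ = 0` into `3J_{χ²} − κ⋆(Z_{χ²} + W_{χ²}) = (layer integral)`; every layer term carries `∇χ` or a derivative falling on `ψ`
and is `≤ C(A, A_E)·(R^{-5/16} log R)·(1 + bulk(4R))` after one integration by parts on the `ΔV`, `Δ²V` pairings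
(every junk term is `≤ o_R(1)·(layer bulk)^{1/2}·(A_E R)^{1/2}ℓ^{-1}`-type by Cauchy–Schwarz against the light layer and
the linear-growth bound `‖∇ψ‖_{L²(B_{2R})} ≲ (A_E R)^{1/2}`, or carries `|ψ|ℓ^{-2} ≲ √A_E log R · R^{-7/4}`); doubling converts
`bulk(4R)` into `D·bulk(R)` (the `‖∇²ψ‖_{L²}`, Calderón–Zygmund, terms) and the light layer converts the weights `χ², χ³` into the
indicator of `B(c,R)` at cost `A₁·η·bulk(R)`.  Why it might fail: the gauge bound and the layer
book-keeping are g9's `CompanionHalf` error budget at first order only (no admissibility, no flat start) — unwritten, M. -/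
def FirstOrderIdentity : Prop :=
  ∀ (A : ℕ → ℝ) (A_E : ℝ) (V : E3 → E3), (∀ j, 1 ≤ A j) → 0 < A_E → InLimitClass A A_E V →
    ∀ (D ε : ℝ), 0 < D → 0 < ε → ∃ η R₁ : ℝ, 0 < η ∧ 0 < R₁ ∧ ∀ (c : E3) (R : ℝ), R₁ ≤ R → IsDoubling V c R D →
      (Zb V c (R + R ^ (7 / 8 : ℝ)) + Wb V c (R + R ^ (7 / 8 : ℝ))) - (Zb V c R + Wb V c R) ≤ η * (Zb V c R + Wb V c R) →
      |3 * Jb V c R - kStar * (Zb V c R + Wb V c R)| ≤ ε * (1 + Zb V c R + Wb V c R)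

/-! ## §2′ TEXTS OF RECORD of the large-scale re-typing S1a′ / S1b′ (REV 1.3 of `Lines/two_thirds.lean`, §2′ VERBATIM, no `Sig.` prefix;
appended by prover ns-net-p2 g12 after idea-crit-4's 14:07:21Z ruling; author ns-idea-10) -/

/-- S1a′ · TYPICAL SELECTION AT LARGE SCALES (L; the intended text of S1a after idea-crit-4's 14:07:21Z ruling).  VERBATIM
`TypicalSelection` except that a threshold `i₁ : ℕ` is chosen right after `θ₀, K` — BEFORE `∀ R η m` and before the flow, so
`i₁ = i₁(θ₀, K; A, A_E)` cannot see `v`, `m`, `R` or `η` — and clause (c) is asked only at the scales `i₁ ≤ i < m`.  This is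
exactly the content the written mechanism proves (localised sharp inequality for `curl(χψ)` + `typicality_abstract`, whose
localisation junk `j_r ≲ C(A, A_E) r^{-β}` is small only for `r ≥ 4^{i₁}`); the dropped regime `4^i ≤ 2·4^{i₁}` was never used
downstream (S1b passes to the limit scale by scale and needs the good balls only cofinally).  NOT «S1a refuted»: ns-net-p2's
finding is a proof-route gap at small scales (clause (i)'s large-`δ` bad event = palinstrophy-poor «fat cores» with no
junk-free enstrophy bound), recorded as such. -/
def TypicalSelectionLarge : Prop :=
  ∀ A : ℕ → ℝ, (∀ j, 1 ≤ A j) → ∀ A_E : ℝ, 0 < A_E → ∃ θ₀ K : ℝ, 0 < θ₀ ∧ 0 < K ∧ ∃ i₁ : ℕ,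
    ∀ (R η : ℝ) (m : ℕ), 0 < R → 0 < η → ∃ ε₀ : ℝ, 0 < ε₀ ∧
    ∀ (v : E3 → E3) (M B ε : ℝ), IsAdm v M B → IsReg A v M → 0 < Zen v → 0 < Wpa v → 0 ≤ ε → ε ≤ ε₀ →
      (kStar - ε) * M * Real.sqrt (Zen v) * Real.sqrt (Wpa v) ≤ Jst v →
      (∀ (y : E3) (r : ℝ), 0 < r → ∫ x in Metric.ball y (r * lam v), ‖v x‖ ^ 2 ≤ A_E * M ^ 2 * lam v ^ 3 * r) →
      ∃ x₀ : E3, θ₀ * M * (lam v)⁻¹ ≤ ‖curl v x₀‖ ∧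
        (∀ φ : E3 → E3, IsTestAt v M φ → tsupport φ ⊆ Metric.ball x₀ (R * lam v) →
          locGain (kStar * M) (lam v) v φ ≤ η * M ^ 3) ∧
        ∀ i : ℕ, i₁ ≤ i → i < m → ∃ (c : E3) (r : ℝ), dist c x₀ ≤ r * lam v / 2 ∧ (4 : ℝ) ^ i ≤ r ∧
          r ≤ 2 * (4 : ℝ) ^ i ∧ IsGoodBallAt v M (lam v) c r (K / (i + 1))

/-- S1b′ · EXTREMAL EXTRACTION FROM THE LARGE-SCALE SELECTION (M).  VERBATIM the consequent of `ExtremalExtraction`, with the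
hypothesis `TypicalSelection` replaced by the weaker `TypicalSelectionLarge`; re-lands by p720680's proof with `max i₀ i₁`
(ns-net-p2 14:02:06Z; idea-crit-4 (1)). -/
def ExtremalExtractionLarge : Prop :=
  TypicalSelectionLarge →
  ∀ (C ν T : ℝ) (u : ℝ → E3 → E3) (p : ℝ → E3 → ℝ), IsViolator C ν T u p →
    ∃ (A : ℕ → ℝ) (A_E : ℝ) (V : E3 → E3) (K b₀ D : ℝ), (∀ j, 1 ≤ A j) ∧ 0 < A_E ∧ InLimitClass A A_E V ∧
      0 < K ∧ 0 < b₀ ∧ 0 < D ∧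
      ∀ i₀ : ℕ, ∃ (i : ℕ) (c : E3) (r : ℝ), i₀ ≤ i ∧ (4 : ℝ) ^ i ≤ r ∧ r ≤ 2 * (4 : ℝ) ^ i ∧ b₀ ≤ Zb V c r ∧
        IsDoubling V c r D ∧ IsGoodBall V c r (K / (i + 1))

end Summit.NavierStokesRegularity.NavierStokesRegularity.Theorems.NearExtremalTransiencePerFlow.TwoThirds

end
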